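import Literature.AlgebraicGeometry.HodgeTheory.HodgeSectionRestrictionOfCupPairing
import Literature.AlgebraicGeometry.HodgeTheory.HardLefschetzHodgeRiemannHolds
import Literature.AlgebraicGeometry.HodgeTheory.SaitoGrFDeRhamCurveNetHolds
import Literature.AlgebraicGeometry.Resolution.ProjectiveResolutionProofs
import HarnessLib

/-!
# BFNP Lemma 50 `hodgeSectionRestriction_of_hodgeConjectureFor` holds (discharge of the named fact)

Family `hodge`, layer `Literature/AlgebraicGeometry/HodgeTheory`. Theorems-only companion (no definition,
no named fact; D-0026) of `HodgeSectionRestriction` (the named fact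
`hodgeSectionRestriction_of_hodgeConjectureFor`: Brosnan–Fang–Nie–Pearlstein, *Singularities of
admissible normal functions*, Invent. Math. 177 (2009), §6 Lemma 50 with Lemma 49 — on a smooth
projective `2n`-fold satisfying the Hodge conjecture, every non-zero rational `(n,n)`-class restricts
non-trivially to some hypersurface section `X ∩ V₊(F)`, `deg F ≥ 1`, `F ∉ I(X)`) and of
`HodgeSectionRestrictionOfCupPairing`, whose glue
`hodgeSectionRestriction_of_hodgeConjectureFor_of_cupPairing_of_gysinKernel` derives the fact from three
named facts of the tree: the perfect pairing on Hodge classes (6.1)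
`hodgeClasses_cupPairing_nondegenerate d X`, Deligne's Hodge III Cor. 8.2.8
`Deligne1974_ker_restrictCompl_eq_iSup_range_complexGysin` and projective resolution of singularities
`Resolution.Hironaka1964_projective` ("none is [discharged], at the time of writing", 2026-08-15).

All three have since been PROVED in the tree — `hardLefschetz_hodgeRiemann_holds` (whence (6.1) through
`hardLefschetz_hodgeRiemann.hodgeClasses_cupPairing_nondegenerate`, file `HardLefschetzHodgeRiemannHolds`),
`Deligne1974_ker_restrictCompl_eq_iSup_range_complexGysin_holds` (file `SaitoGrFDeRhamCurveNetHolds`) and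
`Resolution.Hironaka1964_projective_holds` (file `Resolution/ProjectiveResolutionProofs`) — so this file
records:

* `hodgeClasses_cupPairing_nondegenerate_holds` — BFNP (6.1) for every `(d, X)`, by name;
* `hodgeSectionRestriction_of_hodgeConjectureFor_holds` — **discharge of the named fact** (Gysin route);
* `forall_le_exists_sectionRestriction_ne_zero_of_hodgeConjectureFor` — the ALL-LARGE-DEGREES form for
  one `2n`-fold (the tree's `forall_le_exists_sectionRestriction_ne_zero_of_cupPairing_of_gysinKernel`
  with its three fact hypotheses discharged).

## References

* [BrosnanFangNiePearlstein2009] P. Brosnan, H. Fang, Z. Nie, G. Pearlstein, Singularities of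
  admissible normal functions, Invent. Math. 177 (2009) 599–629, §6 (6.1), Lemmas 49–50
  (arXiv:0711.0964, p. 13).
* [DeligneHodgeIII1974] P. Deligne, Théorie de Hodge III, Publ. Math. IHÉS 44 (1974), Cor. 8.2.8.
* [Kollar2007] J. Kollár, Lectures on Resolution of Singularities (2007), Thm. 3.27. [Hironaka1964]
* [VoisinHodgeI2002] C. Voisin, Hodge Theory and Complex Algebraic Geometry I (CUP 2002), Thm. 6.25,
  Thm. 6.32, §7.1.2.
-/

noncomputable section

open AlgebraicGeometry
open scoped ContinuousMap

namespace Literature.AlgebraicGeometry.HodgeTheory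

section HodgeTheory

open Literature.AlgebraicTopology.SingularHomology

section Pairing

variable {d : ℕ} {X : Motives.SchemeOver ℂ}

/-- **BFNP (6.1) holds for every `(d, X)`**: the cup product is a perfect pairing on the rational Hodge
classes of every smooth projective complex `d`-fold — the named fact
`hodgeClasses_cupPairing_nondegenerate d X` by name, from the proved Kähler package
`hardLefschetz_hodgeRiemann_holds` through `hardLefschetz_hodgeRiemann.hodgeClasses_cupPairing_nondegenerate`.
[cite: BrosnanFangNiePearlstein2009, §6 (6.1)] [cite: VoisinHodgeI2002, Thm. 6.25 and Thm. 6.32] -/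
theorem hodgeClasses_cupPairing_nondegenerate_holds : hodgeClasses_cupPairing_nondegenerate d X :=
  hardLefschetz_hodgeRiemann_holds.hodgeClasses_cupPairing_nondegenerate

end Pairing

/-- **Discharge of the named fact `hodgeSectionRestriction_of_hodgeConjectureFor`** (Brosnan–Fang–Nie–
Pearlstein 2009, §6 Lemma 50 with Lemma 49): on a smooth projective `2n`-fold (`n ≥ 1`) satisfying
`HodgeConjectureFor (2n) X`, every non-zero rational `(n,n)`-class restricts non-trivially to some
hypersurface section `e⁻¹ V₊(F) ≠ X`, `deg F ≥ 1`. The tree's glue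
`hodgeSectionRestriction_of_hodgeConjectureFor_of_cupPairing_of_gysinKernel` (Gysin route: the perfect
pairing gives an algebraic `a` with `c ∪ a ≠ 0`, Deligne's Cor. 8.2.8 and resolutions turn it into
`c|_{Zᵢ} ≠ 0`, Lemma 49 supplies the hypersurface through `Zᵢ`) fed with the three discharges
`hodgeClasses_cupPairing_nondegenerate_holds`, `Deligne1974_ker_restrictCompl_eq_iSup_range_complexGysin_holds`,
`Resolution.Hironaka1964_projective_holds`. [cite: BrosnanFangNiePearlstein2009, §6 Lemma 49 and Lemma 50]
[cite: DeligneHodgeIII1974, Cor. 8.2.8] [cite: Kollar2007, Thm. 3.27] -/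
theorem hodgeSectionRestriction_of_hodgeConjectureFor_holds :
    hodgeSectionRestriction_of_hodgeConjectureFor :=
  hodgeSectionRestriction_of_hodgeConjectureFor_of_cupPairing_of_gysinKernel
    (fun _ _ ↦ hodgeClasses_cupPairing_nondegenerate_holds)
    Deligne1974_ker_restrictCompl_eq_iSup_range_complexGysin_holds Resolution.Hironaka1964_projective_holds

variable {n : ℕ} {X : Motives.SchemeOver ℂ}

/-- **BFNP Lemma 50 in ALL LARGE DEGREES, for one `2n`-fold, unconditionally in the facts**: for `X`
smooth projective of dimension `2n ≥ 2` with `HodgeConjectureFor (2n) X` and a non-zero rational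
`(n,n)`-class `c`, there is `k₀ ≥ 1` such that for EVERY `k ≥ k₀` some hypersurface section
`Z = e⁻¹ V₊(F) ≠ X`, `F` homogeneous of degree `k`, has `c|_{Z(ℂ)} ≠ 0` (printed: "there is an integer
`N` such that, for every `m ≥ N`, there exists `p ∈ |𝓛^m|` such that `ζ|_{𝒳_p} ≠ 0`"). The tree's
`forall_le_exists_sectionRestriction_ne_zero_of_cupPairing_of_gysinKernel` with its three named-fact
hypotheses discharged. [cite: BrosnanFangNiePearlstein2009, §6 Lemma 50 and proof of Thm. 51]
[cite: DeligneHodgeIII1974, Cor. 8.2.8] [cite: Kollar2007, Thm. 3.27] -/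
theorem forall_le_exists_sectionRestriction_ne_zero_of_hodgeConjectureFor (hn : 0 < n)
    (hX : Motives.IsSmoothProjective (2 * n) X) (hHC : HodgeConjectureFor (2 * n) X)
    (e : Motives.ProjectiveEmbedding X) (c : complexBetti X (2 * n)) (hc : IsRationalClass c)
    (hHt : IsOfHodgeType (2 * n) X (2 * n) n n c) (hne : c ≠ 0) :
    ∃ k₀ : ℕ, 0 < k₀ ∧ ∀ k : ℕ, k₀ ≤ k →
      ∃ (F : MvPolynomial (Fin (e.n + 1)) ℂ) (Z : Set X.left), F.IsHomogeneous k ∧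
        Z = e.ι.left.base ⁻¹' (letI := MvPolynomial.gradedAlgebra (σ := Fin (e.n + 1)) (R := ℂ);
          ProjectiveSpectrum.zeroLocus (MvPolynomial.homogeneousSubmodule (Fin (e.n + 1)) ℂ) {F}) ∧
        Z ≠ Set.univ ∧
        singularCohomology.map ℂ ℂ
          (⟨Subtype.val, continuous_subtype_val⟩ :
            C({P : Motives.ComplexPoints X // P.pt ∈ Z}, Motives.ComplexPoints X)) (2 * n) c ≠ 0 :=
  forall_le_exists_sectionRestriction_ne_zero_of_cupPairing_of_gysinKernel
    Deligne1974_ker_restrictCompl_eq_iSup_range_complexGysin_holds Resolution.Hironaka1964_projective_holds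
    hn hX hHC hodgeClasses_cupPairing_nondegenerate_holds e c hc hHt hne

end HodgeTheory

end Literature.AlgebraicGeometry.HodgeTheory

end
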